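import Summits.QuantumFields.YangMills.Theorems.BalabanUVNodesN11SupplierObligationsOfCondExp
import Summits.QuantumFields.YangMills.Theorems.BalabanUVNodesN11GaussianCertificateRows

/-!
# DAG node N11 — AT A PARAMETER OF THE GAUSSIAN CERTIFICATE CLASS: N11's one-token residual `SupplyChainAt θ p`, THEOREM 1 OF [III] AND THE THEOREM OF p. 245 (law form),
# ALL LEVELS, FROM A §3 SUPPLIER's TERM DATA, ITS NEW-TERM BOUNDS AND THE CONDITIONAL-EXPECTATION IDENTITIES — NO residual row, NO K0b row, NO `ZhUnity`

HEADER — WORK-UNIT METADATA.  Cell `pub-ymgap`, YM-PLAN Track A (HUMAN RULING D-0062), seat `pub-ymgap-dag-n11-d` (g16; R134 fan-out base seat N11 [B14], strategy s2),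
route `BalabanUVNodes`, item K1⁹ `StabilityBRunRowsAtRecordR13SepCoPHV` = stmt-QuantumFields-27364 (helper lane, `--kind proof --supports 27364 --as helper`, count-neutral).
[III] = [Balaban1988Convergent], [IV] = [Balaban1989LargeFieldI].  Composition of this seat's `…N11SupplierObligationsOfCondExp.supplierObligations_of_bounds_of_condExp` with
dag-n11-w1's `…N11GaussianCertificateRows` (`measurable_ζ0_of_gaussCert`, `measurable_quad_of_gaussCert`: in the class the residual-measurability rows are theorems of the core
provisos) and dag-n11-e's `…Sect3SupplyChainObligationsDefs` (`noExpansionObligation_of_gaussCert_of_operandRows`: in the class the no-expansion obligation follows from the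
supplier's locality and operand rows alone — dag-n11-w3's `operandRowsAlongChain_of_supplierTermRows`; `sLaw₁₃CoPH_all_of_supplyChainAt`, `thmP245Laws_of_supplyChainAt`).

WHY THIS FILE.  The generic-`θ` capstone (`…N11Thm1LawsOfCondExp`) still displays dag-n11-e's witness-free `ResidualRows θ p` (pins + measurability + K0b's A-fibre domination)
and `ZhUnity`.  At a parameter of dag-n11-w1's GAUSSIAN CERTIFICATE CLASS (`hζ`: the certificate's `ζ0`; `hq`: `quad_j(Λ′)(ω) = Σ_{b ∈ bonds_j(Λ′ᶜ ∩ Ω_{j+1})} ‖A_j(b)‖²`; every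
parameter carrying the K⁷ antecedent re-pins into the class, `exists_gaussCert_of_antecedent` ∕ `antecedent_gaussPinH`) every such row is a theorem.  So THERE the -d lane's road
reads with NOTHING displayed but the core provisos, the live-selector keys, `1 ≤ M`, and the §3 supplier's content: its term data (locality, universality in 𝐄, the 𝐄-clauses,
term rows), [III] Thm 2's new-term BOUNDS at the 𝐓-present children, and THE CONDITIONAL-EXPECTATION IDENTITIES (hce).  (CAVEAT, dag-n11-w4 ∕ -w1's word carried: the class's `quad` is a
RANGE value (unit covariance) serving the no-expansion analysis, NOT node00-def-K0b's value of record `⟨A_j, 𝒬_j A_j⟩`; (hce)'s right member reads `WtOfRecord₁₃H θ p s′` AS IT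
IS, so at a class parameter the displayed identities integrate the new fluctuation field against the range Gaussian — a supplier built from print meets the generic-`θ` edition
`…N11Thm1LawsOfCondExp` at the parameter of record, and THIS edition only where the class's `quad` is the record's.  The class buys the residual ∕ K0b rows, not Thm 2.)

WHAT THIS FILE PROVES (0 `def`, 0 `sorry`, standard axioms).  ★★★ `supplyChainAt_of_bounds_of_condExp_of_gaussCert` · ★★★ `sLaw₁₃CoPH_all_of_bounds_of_condExp_of_gaussCert` ·
★★★ `thmP245Laws_of_bounds_of_condExp_of_gaussCert`.

HONEST FRAMING.  Helper lane of K1⁹; count-neutral; compositions BY NAME; the class hypotheses, the supplier's data, (hbounds) and (hce) DISPLAYED — the last two are [III]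
Thm 2 + [I] §2, NOT proved; no supplier constructed; (B4) ∕ (S-α) ∕ (O3′) NOT closed; N11 NOT discharged; K1⁹ NOT closed, no registered stub touched; counts unmoved (typed
28∕28 · discharged 5∕27 · A 5∕28).  One finite `𝕋⁴_{L^K}` programme at fixed `ε = L^{−K}`; R4 closes only the conditional finite-𝕋⁴ rung `BalabanLadder.UV` — NOT ℝ⁴, NOT
OS, NOT a mass gap, NOT Clay.  No `sorry`, `axiom`, `def`, `instance`, `notation`.  Sources (SHAPE ∕ bookkeeping only): [III] Thm 1 p.262, Theorem p.245, remark p.262, Thm 2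
p.263, §3 p.279, (2.23) p.258, (2.27)–(2.31) pp.259–260, (2.38)–(2.42) p.261, (3.1) p.264, (3.23)–(3.25) p.270; [IV] (0.2)–(0.4) p.176, p.177 (i)–(ii).
-/

noncomputable section

open MeasureTheory ProbabilityTheory
open scoped ENNReal NNReal BigOperators Matrix.Norms.L2Operator

namespace Summit.QuantumFields.YangMills.Theorems.BalabanUVNodesN11Thm1LawsOfCondExpGaussCert

open Literature.MathematicalPhysics.QuantumFieldTheory.Balaban1983to89
open Literature.MathematicalPhysics.QuantumFieldTheory.Balaban1983to89.T4AveragingDisintegration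
open BalabanUVNodesN11SupplierObligationsOfCondExp (supplierObligations_of_bounds_of_condExp)
open BalabanUVNodesN11GaussianCertificateRows (measurable_ζ0_of_gaussCert measurable_quad_of_gaussCert)
open BalabanUVNodesN11HistoryPinnedResidualDefs (ZhPinOfRecord₁₃)
open BalabanUVNodesN11FluctTruncationDefs (IsFluctLocal)
open BalabanUVNodesN11Sect3SupplyChainDefs (Sect3Supplier chainWitness NewEClausesAt)
open BalabanUVNodesN11Sect3SupplyChainObligationsDefs (ChainFormAt SupplyChainAt noExpansionObligation_of_gaussCert_of_operandRows sLaw₁₃CoPH_all_of_supplyChainAt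
  thmP245Laws_of_supplyChainAt)
open BalabanUVNodesN11Sect3SupplyChainTermRows (SupplierTermRows operandRowsAlongChain_of_supplierTermRows)
open BalabanUVNodesN11Sect3SupplySpliceOwnBoundary (graftAboveB)
open Node00 hiding SU
open Node00.Tk T4Continuum B14.Eq218Concrete
open B10Eq42TorusConstraint (bondsIn)

variable {F : T4Family} {N : ℕ} [NeZero N]

/-- ★★★ **N11's ONE-TOKEN RESIDUAL `SupplyChainAt θ p` AT A GAUSSIAN-CLASS PARAMETER FROM THE §3 SUPPLIER's TERM DATA, NEW-TERM BOUNDS AND CONDITIONAL-EXPECTATION IDENTITIES —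
NOTHING ELSE but the core provisos and `1 ≤ M`.** [cite: Balaban1988Convergent, Thm 1 p.262, Theorem p.245, Thm 2 p.263, §3 p.279, (3.23)–(3.25) p.270, (2.23) p.258] -/
theorem supplyChainAt_of_bounds_of_condExp_of_gaussCert (θ : Stage13HParams F N)
    -- the Gaussian certificate class (dag-n11-w1): the certificate's `ζ0`, the Gaussian of the integrated variables as `quad`
    (hζ : ∀ (p : B12.RunParams) (n : ℕ) (Ω Λ : ℕ → Set (Site (F.P p.K) 0)), (θ.Zh p n Ω Λ).ζ0 = (ZhPinOfRecord₁₃ θ.toStage13Params p Ω Λ).ζ0)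
    (hq : ∀ (p : B12.RunParams) (n : ℕ) (Ω Λ : ℕ → Set (Site (F.P p.K) 0)) (j : ℕ) (Λ' : Set (Site (F.P p.K) 0)) (ω : MultiCfg (F.P p.K) (SU N) (FluctV N)),
      (θ.Zh p n Ω Λ).quad j Λ' ω = ∑ b ∈ (Set.toFinite (bondsIn j (Λ'ᶜ ∩ Ω (j + 1)))).toFinset, ‖(ω j).2 b‖ ^ 2)
    (h : θ.Provisos₁₃CoPH F N) (hM : 1 ≤ θ.τ9.M) (p : B12.RunParams)
    (σ : Sect3Supplier θ p)
    -- the supplier's own data: locality (2.40)–(2.41), universality in 𝐄, the level-`(k+1)` 𝐄-clauses, the term rows of its constructed terms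
    (hloc : ∀ k (s : SeqOfRecord F θ.ν θ.τ9.M (gOfRecord₁₃ F N θ.toStage13Params p) p.K (k + 1)), IsFluctLocal (k + 1) ((σ k (chainWitness θ p σ k).1 (chainWitness θ p σ k).2).1 s))
    (hunivE : ∀ k, k < p.K → ChainFormAt θ p σ k → Sect2.UniversalE (σ k (chainWitness θ p σ k).1 (chainWitness θ p σ k).2).1)
    (hnewE : ∀ k, k < p.K → ChainFormAt θ p σ k →
      ∀ s : SeqOfRecord F θ.ν θ.τ9.M (gOfRecord₁₃ F N θ.toStage13Params p) p.K (k + 1), NewEClausesAt θ p k ((σ k (chainWitness θ p σ k).1 (chainWitness θ p σ k).2).1 s) s)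
    (hσ : SupplierTermRows θ p σ)
    -- THE NEW-TERM BOUNDS (O1′) + (O2) of [III] Thm 2 at every 𝐓-present child, for the supplier's response (displayed)
    (hbounds : ∀ k (hkK : k < p.K), ChainFormAt θ p σ k →
      ∀ s' : SeqOfRecord F θ.ν θ.τ9.M (gOfRecord₁₃ F N θ.toStage13Params p) p.K (k + 1), s'.Ω (k + 1) ≠ ∅ →
      slotsTOfRecord F N θ.ν θ.τ9 (EOfRecord₁₃ F N θ.toStage13Params) (wOfRecord₉ F N θ.toStage9Params) θ.ppSel p (gOfRecord₁₃ F N θ.toStage13Params p) (k + 1) s' ≠ 0 →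
      (1 ≤ k →
        (∀ (X : (Sect2.domSys (F.P p.K) θ.τ9.M k).Dom) (φ : Sect2.CPair (F.P p.K) (MatA N)) (a : SFluct (F.P p.K) (FluctV N)),
          φ ∈ (sect2TowerOfRecord F N (FluctV N) p.K (settingOfRecord₁₃ F N θ.toStage13Params p) (θ.rzAt p s') s' ((σ k (chainWitness θ p σ k).1 (chainWitness θ p σ k).2).1 s')).spaceB k X →
            ‖((σ k (chainWitness θ p σ k).1 (chainWitness θ p σ k).2).1 s').B k X φ a‖ ≤ (settingOfRecord₁₃ F N θ.toStage13Params p).lf.B₀ * Real.exp (-(settingOfRecord₁₃ F N θ.toStage13Params p).lf.κ * (Sect2.domSys (F.P p.K) θ.τ9.M k).dj X)) ∧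
        (∀ (X : (Sect2.domSys (F.P p.K) θ.τ9.M k).Dom) (a : SFluct (F.P p.K) (FluctV N)),
          AnalyticOnNhd ℂ (fun φ => ((σ k (chainWitness θ p σ k).1 (chainWitness θ p σ k).2).1 s').B k X φ a) ((sect2TowerOfRecord F N (FluctV N) p.K (settingOfRecord₁₃ F N θ.toStage13Params p) (θ.rzAt p s') s' ((σ k (chainWitness θ p σ k).1 (chainWitness θ p σ k).2).1 s')).spaceB k X))) ∧
      Step.LFNewTerms (sect2TowerOfRecord F N (FluctV N) p.K (settingOfRecord₁₃ F N θ.toStage13Params p) (θ.rzAt p s') s' ((σ k (chainWitness θ p σ k).1 (chainWitness θ p σ k).2).1 s')) (settingOfRecord₁₃ F N θ.toStage13Params p).lf (settingOfRecord₁₃ F N θ.toStage13Params p).βc k ∧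
      (∀ (X : (Sect2.domSys (F.P p.K) θ.τ9.M (k + 1)).Dom) (z : Site (F.P p.K) (k + 1)) (g : ℝ), 0 ≤ g → g ≤ (settingOfRecord₁₃ F N θ.toStage13Params p).lf.γ →
        AnalyticOnNhd ℂ (((σ k (chainWitness θ p σ k).1 (chainWitness θ p σ k).2).1 s').E (k + 1) X z g)
          ((sect2TowerOfRecord F N (FluctV N) p.K (settingOfRecord₁₃ F N θ.toStage13Params p) (θ.rzAt p s') s' ((σ k (chainWitness θ p σ k).1 (chainWitness θ p σ k).2).1 s')).space (k + 1) X ((settingOfRecord₁₃ F N θ.toStage13Params p).lf.alpha0 ((settingOfRecord₁₃ F N θ.toStage13Params p).flow.g (k + 1))) ((settingOfRecord₁₃ F N θ.toStage13Params p).lf.alpha1 ((settingOfRecord₁₃ F N θ.toStage13Params p).flow.g (k + 1))))) ∧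
      (∀ X : (Sect2.domSys (F.P p.K) θ.τ9.M (k + 1)).Dom,
        AnalyticOnNhd ℂ (((σ k (chainWitness θ p σ k).1 (chainWitness θ p σ k).2).1 s').R (k + 1) X)
          ((sect2TowerOfRecord F N (FluctV N) p.K (settingOfRecord₁₃ F N θ.toStage13Params p) (θ.rzAt p s') s' ((σ k (chainWitness θ p σ k).1 (chainWitness θ p σ k).2).1 s')).space (k + 1) X ((settingOfRecord₁₃ F N θ.toStage13Params p).lf.alpha0 ((settingOfRecord₁₃ F N θ.toStage13Params p).flow.g (k + 1))) ((settingOfRecord₁₃ F N θ.toStage13Params p).lf.alpha1 ((settingOfRecord₁₃ F N θ.toStage13Params p).flow.g (k + 1))))) ∧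
      (∀ (X : (Sect2.domSys (F.P p.K) θ.τ9.M (k + 1)).Dom) (a : SFluct (F.P p.K) (FluctV N)),
        AnalyticOnNhd ℂ (fun φ => ((σ k (chainWitness θ p σ k).1 (chainWitness θ p σ k).2).1 s').B (k + 1) X φ a) ((sect2TowerOfRecord F N (FluctV N) p.K (settingOfRecord₁₃ F N θ.toStage13Params p) (θ.rzAt p s') s' ((σ k (chainWitness θ p σ k).1 (chainWitness θ p σ k).2).1 s')).spaceB (k + 1) X)))
    -- THE CONDITIONAL-EXPECTATION IDENTITIES: per level `k < K` with Theorem 1's inductive hypothesis, per 𝐓-present child `s′` with `𝐓ρ_k(s′) ≢ 0`, per old branch `S₀`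
    (hce : ∀ k (hkK : k < p.K), ChainFormAt θ p σ k →
      ∀ s' : SeqOfRecord F θ.ν θ.τ9.M (gOfRecord₁₃ F N θ.toStage13Params p) p.K (k + 1), s'.Ω (k + 1) ≠ ∅ →
      slotsTOfRecord F N θ.ν θ.τ9 (EOfRecord₁₃ F N θ.toStage13Params) (wOfRecord₉ F N θ.toStage9Params) θ.ppSel p (gOfRecord₁₃ F N θ.toStage13Params p) (k + 1) s' ≠ 0 →
      ∀ S₀ ∈ admSOfRecord F θ.ν θ.τ9.M (gOfRecord₁₃ F N θ.toStage13Params p) p.K k s'.init, kernelTransport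
        ((Measure.pi fun _ : ↥(Set.toFinite (bondsIn k (s'.Ω (k + 1))ᶜ)).toFinset => (HaarData.haar : Measure (SU N))).prod
          (Measure.pi fun _ : {b : PBond (F.P p.K) k // b ∉ (Set.toFinite (bondsIn k (s'.Ω (k + 1))ᶜ)).toFinset} => (HaarData.haar : Measure (SU N))))
        ((Measure.pi fun _ : ↥(Set.toFinite (bondsIn k (s'.Ω (k + 1))ᶜ)).toFinset => (HaarData.haar : Measure (SU N))).prod
          (Measure.pi fun _ : {c : PBond (F.P p.K) (k + 1) // c ∉ (Set.toFinite (bondsIn (k + 1) (s'.Ω (k + 1))ᶜ)).toFinset} =>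
            (HaarData.haar : Measure (SU N))))
        (fun q => (q.1, fun c : {c : PBond (F.P p.K) (k + 1) // c ∉ (Set.toFinite (bondsIn (k + 1) (s'.Ω (k + 1))ᶜ)).toFinset} =>
          (avOfRecord F N p.K k).avg
            ((MeasurableEquiv.piEquivPiSubtypeProd (fun _ : PBond (F.P p.K) k => SU N)
              (· ∈ (Set.toFinite (bondsIn k (s'.Ω (k + 1))ᶜ)).toFinset)).symm q) c))
        ((fun U => wOfRecord₉ F N θ.toStage9Params p (gOfRecord₁₃ F N θ.toStage13Params p) k s' U ((avOfRecord F N p.K k).avg U) *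
            (chiSeqOfRecord F N θ.ν θ.τ9.M (gOfRecord₁₃ F N θ.toStage13Params p) p.K k s'.init U *
              tkBranchOfRecord F N (FluctV N) θ.ν θ.τ9.M (gOfRecord₁₃ F N θ.toStage13Params p) p.K (WtOfRecord₁₃H F N θ p s'.init) s'.init S₀ k
                (fun ω => (sect2Operand F N (FluctV N) p.K (settingOfRecord₁₃ F N θ.toStage13Params p) (θ.rzAt p s'.init) s'.init ((chainWitness θ p σ k).1 s'.init) ((chainWitness θ p σ k).2 s'.init)
            (UbgOfRecord₁₃CoP F N θ.toStage13Params p k s'.init)) (S₀, fun j => (ω j).2) (fun j => (ω j).1)) (baseCfg k U))) ∘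
          ⇑(MeasurableEquiv.piEquivPiSubtypeProd (fun _ : PBond (F.P p.K) k => SU N)
            (· ∈ (Set.toFinite (bondsIn k (s'.Ω (k + 1))ᶜ)).toFinset)).symm)
      =ᵐ[((Measure.pi fun _ : ↥(Set.toFinite (bondsIn k (s'.Ω (k + 1))ᶜ)).toFinset => (HaarData.haar : Measure (SU N))).prod
          (Measure.pi fun _ : {c : PBond (F.P p.K) (k + 1) // c ∉ (Set.toFinite (bondsIn (k + 1) (s'.Ω (k + 1))ᶜ)).toFinset} =>
            (HaarData.haar : Measure (SU N))))]
        fun z => ∑ Y ∈ (Set.toFinite {Y : Set (Site (F.P p.K) 0) | Y ∈ SClassOfRecord F θ.ν (gOfRecord₁₃ F N θ.toStage13Params p) p.K (k + 1) ∧ Y ⊆ s'.Ω (k + 1) ∩ (s'.Λ (k + 1))ᶜ}).toFinset,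
          zetaOp (genDataOfRecord F N (FluctV N) θ.ν θ.τ9.M (gOfRecord₁₃ F N θ.toStage13Params p) p.K (WtOfRecord₁₃H F N θ p s') s' (Function.update S₀ (k + 1) Y) k).ζ
            (aOp k (genDataOfRecord F N (FluctV N) θ.ν θ.τ9.M (gOfRecord₁₃ F N θ.toStage13Params p) p.K (WtOfRecord₁₃H F N θ p s') s' (Function.update S₀ (k + 1) Y) k).sA
              (genDataOfRecord F N (FluctV N) θ.ν θ.τ9.M (gOfRecord₁₃ F N θ.toStage13Params p) p.K (WtOfRecord₁₃H F N θ p s') s' (Function.update S₀ (k + 1) Y) k).w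
              (tkBranchOfRecord F N (FluctV N) θ.ν θ.τ9.M (gOfRecord₁₃ F N θ.toStage13Params p) p.K (WtOfRecord₁₃H F N θ p s') s'.init S₀ k
                (fun ω => (sect2Operand F N (FluctV N) p.K (settingOfRecord₁₃ F N θ.toStage13Params p) (θ.rzAt p s') s' (graftAboveB k ((chainWitness θ p σ k).1 s'.init) ((σ k (chainWitness θ p σ k).1 (chainWitness θ p σ k).2).1 s')) ((σ k (chainWitness θ p σ k).1 (chainWitness θ p σ k).2).2 s')
                  (UbgOfRecord₁₃CoP F N θ.toStage13Params p (k + 1) s')) (Function.update S₀ (k + 1) Y, fun j => (ω j).2) (fun j => (ω j).1))))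
            (Function.update (baseCfg (k + 1) ((MeasurableEquiv.piEquivPiSubtypeProd (fun _ : PBond (F.P p.K) (k + 1) => SU N)
              (· ∈ (Set.toFinite (bondsIn (k + 1) (s'.Ω (k + 1))ᶜ)).toFinset)).symm (avgRestrOfRecord F N p.K k (Set.toFinite (bondsIn k (s'.Ω (k + 1))ᶜ)).toFinset
                (Set.toFinite (bondsIn (k + 1) (s'.Ω (k + 1))ᶜ)).toFinset z.1, z.2))) k
            (Function.updateFinset ((baseCfg (V := FluctV N) (k + 1) ((MeasurableEquiv.piEquivPiSubtypeProd (fun _ : PBond (F.P p.K) (k + 1) => SU N)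
              (· ∈ (Set.toFinite (bondsIn (k + 1) (s'.Ω (k + 1))ᶜ)).toFinset)).symm (avgRestrOfRecord F N p.K k (Set.toFinite (bondsIn k (s'.Ω (k + 1))ᶜ)).toFinset
                (Set.toFinite (bondsIn (k + 1) (s'.Ω (k + 1))ᶜ)).toFinset z.1, z.2))) k).1 (Set.toFinite (bondsIn k (s'.Ω (k + 1))ᶜ)).toFinset z.1,
              ((baseCfg (V := FluctV N) (k + 1) ((MeasurableEquiv.piEquivPiSubtypeProd (fun _ : PBond (F.P p.K) (k + 1) => SU N)
              (· ∈ (Set.toFinite (bondsIn (k + 1) (s'.Ω (k + 1))ᶜ)).toFinset)).symm (avgRestrOfRecord F N p.K k (Set.toFinite (bondsIn k (s'.Ω (k + 1))ᶜ)).toFinset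
                (Set.toFinite (bondsIn (k + 1) (s'.Ω (k + 1))ᶜ)).toFinset z.1, z.2))) k).2))) :
    SupplyChainAt θ p :=
  ⟨σ, supplierObligations_of_bounds_of_condExp θ h p σ hloc hunivE hnewE hσ (fun _ s j Y => measurable_ζ0_of_gaussCert θ p hζ h s j Y)
      (fun _ s j Λ' => measurable_quad_of_gaussCert θ p hq s j Λ') hbounds hce,
    noExpansionObligation_of_gaussCert_of_operandRows hζ hq h hM σ hloc (operandRowsAlongChain_of_supplierTermRows hσ)⟩

/-- ★★★ **THEOREM 1 OF [III] AT A GAUSSIAN-CLASS `θ`, ALL LEVELS `k ≤ K`, FROM THE §3 SUPPLIER's TERM DATA, NEW-TERM BOUNDS AND CONDITIONAL-EXPECTATION IDENTITIES** on the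
live-selector line (core provisos, selector clause, admissibility, `0 ≤ κ, E₀, B₀`, `1 ≤ M`).
[cite: Balaban1988Convergent, Thm 1 p.262, Theorem p.245, Thm 2 p.263, §3 p.279, (3.23)–(3.25) p.270; Balaban1989LargeFieldI, (0.2)–(0.4) p.176, p.177 (i)–(ii)] -/
theorem sLaw₁₃CoPH_all_of_bounds_of_condExp_of_gaussCert (θ : Stage13HParams F N)
    -- the Gaussian certificate class (dag-n11-w1): the certificate's `ζ0`, the Gaussian of the integrated variables as `quad`
    (hζ : ∀ (p : B12.RunParams) (n : ℕ) (Ω Λ : ℕ → Set (Site (F.P p.K) 0)), (θ.Zh p n Ω Λ).ζ0 = (ZhPinOfRecord₁₃ θ.toStage13Params p Ω Λ).ζ0)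
    (hq : ∀ (p : B12.RunParams) (n : ℕ) (Ω Λ : ℕ → Set (Site (F.P p.K) 0)) (j : ℕ) (Λ' : Set (Site (F.P p.K) 0)) (ω : MultiCfg (F.P p.K) (SU N) (FluctV N)),
      (θ.Zh p n Ω Λ).quad j Λ' ω = ∑ b ∈ (Set.toFinite (bondsIn j (Λ'ᶜ ∩ Ω (j + 1)))).toFinset, ‖(ω j).2 b‖ ^ 2)
    (h : θ.Provisos₁₃CoPH F N) (hM : 1 ≤ θ.τ9.M)
    (hsel : θ.ppSel = ppSelLiveOfRecord F N θ.ν θ.τ9 (EOfRecord₁₃ F N θ.toStage13Params) (wOfRecord₉ F N θ.toStage9Params))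
    (hθ : θ.Admissible F N) (hκ : 0 ≤ θ.s2.lf.κ) (hE₀ : 0 ≤ θ.s2.lf.E₀) (hB₀ : 0 ≤ θ.s2.lf.B₀)
    (p : B12.RunParams)
    (σ : Sect3Supplier θ p)
    -- the supplier's own data: locality (2.40)–(2.41), universality in 𝐄, the level-`(k+1)` 𝐄-clauses, the term rows of its constructed terms
    (hloc : ∀ k (s : SeqOfRecord F θ.ν θ.τ9.M (gOfRecord₁₃ F N θ.toStage13Params p) p.K (k + 1)), IsFluctLocal (k + 1) ((σ k (chainWitness θ p σ k).1 (chainWitness θ p σ k).2).1 s))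
    (hunivE : ∀ k, k < p.K → ChainFormAt θ p σ k → Sect2.UniversalE (σ k (chainWitness θ p σ k).1 (chainWitness θ p σ k).2).1)
    (hnewE : ∀ k, k < p.K → ChainFormAt θ p σ k →
      ∀ s : SeqOfRecord F θ.ν θ.τ9.M (gOfRecord₁₃ F N θ.toStage13Params p) p.K (k + 1), NewEClausesAt θ p k ((σ k (chainWitness θ p σ k).1 (chainWitness θ p σ k).2).1 s) s)
    (hσ : SupplierTermRows θ p σ)
    -- THE NEW-TERM BOUNDS (O1′) + (O2) of [III] Thm 2 at every 𝐓-present child, for the supplier's response (displayed)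
    (hbounds : ∀ k (hkK : k < p.K), ChainFormAt θ p σ k →
      ∀ s' : SeqOfRecord F θ.ν θ.τ9.M (gOfRecord₁₃ F N θ.toStage13Params p) p.K (k + 1), s'.Ω (k + 1) ≠ ∅ →
      slotsTOfRecord F N θ.ν θ.τ9 (EOfRecord₁₃ F N θ.toStage13Params) (wOfRecord₉ F N θ.toStage9Params) θ.ppSel p (gOfRecord₁₃ F N θ.toStage13Params p) (k + 1) s' ≠ 0 →
      (1 ≤ k →
        (∀ (X : (Sect2.domSys (F.P p.K) θ.τ9.M k).Dom) (φ : Sect2.CPair (F.P p.K) (MatA N)) (a : SFluct (F.P p.K) (FluctV N)),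
          φ ∈ (sect2TowerOfRecord F N (FluctV N) p.K (settingOfRecord₁₃ F N θ.toStage13Params p) (θ.rzAt p s') s' ((σ k (chainWitness θ p σ k).1 (chainWitness θ p σ k).2).1 s')).spaceB k X →
            ‖((σ k (chainWitness θ p σ k).1 (chainWitness θ p σ k).2).1 s').B k X φ a‖ ≤ (settingOfRecord₁₃ F N θ.toStage13Params p).lf.B₀ * Real.exp (-(settingOfRecord₁₃ F N θ.toStage13Params p).lf.κ * (Sect2.domSys (F.P p.K) θ.τ9.M k).dj X)) ∧
        (∀ (X : (Sect2.domSys (F.P p.K) θ.τ9.M k).Dom) (a : SFluct (F.P p.K) (FluctV N)),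
          AnalyticOnNhd ℂ (fun φ => ((σ k (chainWitness θ p σ k).1 (chainWitness θ p σ k).2).1 s').B k X φ a) ((sect2TowerOfRecord F N (FluctV N) p.K (settingOfRecord₁₃ F N θ.toStage13Params p) (θ.rzAt p s') s' ((σ k (chainWitness θ p σ k).1 (chainWitness θ p σ k).2).1 s')).spaceB k X))) ∧
      Step.LFNewTerms (sect2TowerOfRecord F N (FluctV N) p.K (settingOfRecord₁₃ F N θ.toStage13Params p) (θ.rzAt p s') s' ((σ k (chainWitness θ p σ k).1 (chainWitness θ p σ k).2).1 s')) (settingOfRecord₁₃ F N θ.toStage13Params p).lf (settingOfRecord₁₃ F N θ.toStage13Params p).βc k ∧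
      (∀ (X : (Sect2.domSys (F.P p.K) θ.τ9.M (k + 1)).Dom) (z : Site (F.P p.K) (k + 1)) (g : ℝ), 0 ≤ g → g ≤ (settingOfRecord₁₃ F N θ.toStage13Params p).lf.γ →
        AnalyticOnNhd ℂ (((σ k (chainWitness θ p σ k).1 (chainWitness θ p σ k).2).1 s').E (k + 1) X z g)
          ((sect2TowerOfRecord F N (FluctV N) p.K (settingOfRecord₁₃ F N θ.toStage13Params p) (θ.rzAt p s') s' ((σ k (chainWitness θ p σ k).1 (chainWitness θ p σ k).2).1 s')).space (k + 1) X ((settingOfRecord₁₃ F N θ.toStage13Params p).lf.alpha0 ((settingOfRecord₁₃ F N θ.toStage13Params p).flow.g (k + 1))) ((settingOfRecord₁₃ F N θ.toStage13Params p).lf.alpha1 ((settingOfRecord₁₃ F N θ.toStage13Params p).flow.g (k + 1))))) ∧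
      (∀ X : (Sect2.domSys (F.P p.K) θ.τ9.M (k + 1)).Dom,
        AnalyticOnNhd ℂ (((σ k (chainWitness θ p σ k).1 (chainWitness θ p σ k).2).1 s').R (k + 1) X)
          ((sect2TowerOfRecord F N (FluctV N) p.K (settingOfRecord₁₃ F N θ.toStage13Params p) (θ.rzAt p s') s' ((σ k (chainWitness θ p σ k).1 (chainWitness θ p σ k).2).1 s')).space (k + 1) X ((settingOfRecord₁₃ F N θ.toStage13Params p).lf.alpha0 ((settingOfRecord₁₃ F N θ.toStage13Params p).flow.g (k + 1))) ((settingOfRecord₁₃ F N θ.toStage13Params p).lf.alpha1 ((settingOfRecord₁₃ F N θ.toStage13Params p).flow.g (k + 1))))) ∧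
      (∀ (X : (Sect2.domSys (F.P p.K) θ.τ9.M (k + 1)).Dom) (a : SFluct (F.P p.K) (FluctV N)),
        AnalyticOnNhd ℂ (fun φ => ((σ k (chainWitness θ p σ k).1 (chainWitness θ p σ k).2).1 s').B (k + 1) X φ a) ((sect2TowerOfRecord F N (FluctV N) p.K (settingOfRecord₁₃ F N θ.toStage13Params p) (θ.rzAt p s') s' ((σ k (chainWitness θ p σ k).1 (chainWitness θ p σ k).2).1 s')).spaceB (k + 1) X)))
    -- THE CONDITIONAL-EXPECTATION IDENTITIES: per level `k < K` with Theorem 1's inductive hypothesis, per 𝐓-present child `s′` with `𝐓ρ_k(s′) ≢ 0`, per old branch `S₀`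
    (hce : ∀ k (hkK : k < p.K), ChainFormAt θ p σ k →
      ∀ s' : SeqOfRecord F θ.ν θ.τ9.M (gOfRecord₁₃ F N θ.toStage13Params p) p.K (k + 1), s'.Ω (k + 1) ≠ ∅ →
      slotsTOfRecord F N θ.ν θ.τ9 (EOfRecord₁₃ F N θ.toStage13Params) (wOfRecord₉ F N θ.toStage9Params) θ.ppSel p (gOfRecord₁₃ F N θ.toStage13Params p) (k + 1) s' ≠ 0 →
      ∀ S₀ ∈ admSOfRecord F θ.ν θ.τ9.M (gOfRecord₁₃ F N θ.toStage13Params p) p.K k s'.init, kernelTransport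
        ((Measure.pi fun _ : ↥(Set.toFinite (bondsIn k (s'.Ω (k + 1))ᶜ)).toFinset => (HaarData.haar : Measure (SU N))).prod
          (Measure.pi fun _ : {b : PBond (F.P p.K) k // b ∉ (Set.toFinite (bondsIn k (s'.Ω (k + 1))ᶜ)).toFinset} => (HaarData.haar : Measure (SU N))))
        ((Measure.pi fun _ : ↥(Set.toFinite (bondsIn k (s'.Ω (k + 1))ᶜ)).toFinset => (HaarData.haar : Measure (SU N))).prod
          (Measure.pi fun _ : {c : PBond (F.P p.K) (k + 1) // c ∉ (Set.toFinite (bondsIn (k + 1) (s'.Ω (k + 1))ᶜ)).toFinset} =>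
            (HaarData.haar : Measure (SU N))))
        (fun q => (q.1, fun c : {c : PBond (F.P p.K) (k + 1) // c ∉ (Set.toFinite (bondsIn (k + 1) (s'.Ω (k + 1))ᶜ)).toFinset} =>
          (avOfRecord F N p.K k).avg
            ((MeasurableEquiv.piEquivPiSubtypeProd (fun _ : PBond (F.P p.K) k => SU N)
              (· ∈ (Set.toFinite (bondsIn k (s'.Ω (k + 1))ᶜ)).toFinset)).symm q) c))
        ((fun U => wOfRecord₉ F N θ.toStage9Params p (gOfRecord₁₃ F N θ.toStage13Params p) k s' U ((avOfRecord F N p.K k).avg U) *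
            (chiSeqOfRecord F N θ.ν θ.τ9.M (gOfRecord₁₃ F N θ.toStage13Params p) p.K k s'.init U *
              tkBranchOfRecord F N (FluctV N) θ.ν θ.τ9.M (gOfRecord₁₃ F N θ.toStage13Params p) p.K (WtOfRecord₁₃H F N θ p s'.init) s'.init S₀ k
                (fun ω => (sect2Operand F N (FluctV N) p.K (settingOfRecord₁₃ F N θ.toStage13Params p) (θ.rzAt p s'.init) s'.init ((chainWitness θ p σ k).1 s'.init) ((chainWitness θ p σ k).2 s'.init)
            (UbgOfRecord₁₃CoP F N θ.toStage13Params p k s'.init)) (S₀, fun j => (ω j).2) (fun j => (ω j).1)) (baseCfg k U))) ∘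
          ⇑(MeasurableEquiv.piEquivPiSubtypeProd (fun _ : PBond (F.P p.K) k => SU N)
            (· ∈ (Set.toFinite (bondsIn k (s'.Ω (k + 1))ᶜ)).toFinset)).symm)
      =ᵐ[((Measure.pi fun _ : ↥(Set.toFinite (bondsIn k (s'.Ω (k + 1))ᶜ)).toFinset => (HaarData.haar : Measure (SU N))).prod
          (Measure.pi fun _ : {c : PBond (F.P p.K) (k + 1) // c ∉ (Set.toFinite (bondsIn (k + 1) (s'.Ω (k + 1))ᶜ)).toFinset} =>
            (HaarData.haar : Measure (SU N))))]
        fun z => ∑ Y ∈ (Set.toFinite {Y : Set (Site (F.P p.K) 0) | Y ∈ SClassOfRecord F θ.ν (gOfRecord₁₃ F N θ.toStage13Params p) p.K (k + 1) ∧ Y ⊆ s'.Ω (k + 1) ∩ (s'.Λ (k + 1))ᶜ}).toFinset,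
          zetaOp (genDataOfRecord F N (FluctV N) θ.ν θ.τ9.M (gOfRecord₁₃ F N θ.toStage13Params p) p.K (WtOfRecord₁₃H F N θ p s') s' (Function.update S₀ (k + 1) Y) k).ζ
            (aOp k (genDataOfRecord F N (FluctV N) θ.ν θ.τ9.M (gOfRecord₁₃ F N θ.toStage13Params p) p.K (WtOfRecord₁₃H F N θ p s') s' (Function.update S₀ (k + 1) Y) k).sA
              (genDataOfRecord F N (FluctV N) θ.ν θ.τ9.M (gOfRecord₁₃ F N θ.toStage13Params p) p.K (WtOfRecord₁₃H F N θ p s') s' (Function.update S₀ (k + 1) Y) k).w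
              (tkBranchOfRecord F N (FluctV N) θ.ν θ.τ9.M (gOfRecord₁₃ F N θ.toStage13Params p) p.K (WtOfRecord₁₃H F N θ p s') s'.init S₀ k
                (fun ω => (sect2Operand F N (FluctV N) p.K (settingOfRecord₁₃ F N θ.toStage13Params p) (θ.rzAt p s') s' (graftAboveB k ((chainWitness θ p σ k).1 s'.init) ((σ k (chainWitness θ p σ k).1 (chainWitness θ p σ k).2).1 s')) ((σ k (chainWitness θ p σ k).1 (chainWitness θ p σ k).2).2 s')
                  (UbgOfRecord₁₃CoP F N θ.toStage13Params p (k + 1) s')) (Function.update S₀ (k + 1) Y, fun j => (ω j).2) (fun j => (ω j).1))))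
            (Function.update (baseCfg (k + 1) ((MeasurableEquiv.piEquivPiSubtypeProd (fun _ : PBond (F.P p.K) (k + 1) => SU N)
              (· ∈ (Set.toFinite (bondsIn (k + 1) (s'.Ω (k + 1))ᶜ)).toFinset)).symm (avgRestrOfRecord F N p.K k (Set.toFinite (bondsIn k (s'.Ω (k + 1))ᶜ)).toFinset
                (Set.toFinite (bondsIn (k + 1) (s'.Ω (k + 1))ᶜ)).toFinset z.1, z.2))) k
            (Function.updateFinset ((baseCfg (V := FluctV N) (k + 1) ((MeasurableEquiv.piEquivPiSubtypeProd (fun _ : PBond (F.P p.K) (k + 1) => SU N)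
              (· ∈ (Set.toFinite (bondsIn (k + 1) (s'.Ω (k + 1))ᶜ)).toFinset)).symm (avgRestrOfRecord F N p.K k (Set.toFinite (bondsIn k (s'.Ω (k + 1))ᶜ)).toFinset
                (Set.toFinite (bondsIn (k + 1) (s'.Ω (k + 1))ᶜ)).toFinset z.1, z.2))) k).1 (Set.toFinite (bondsIn k (s'.Ω (k + 1))ᶜ)).toFinset z.1,
              ((baseCfg (V := FluctV N) (k + 1) ((MeasurableEquiv.piEquivPiSubtypeProd (fun _ : PBond (F.P p.K) (k + 1) => SU N)
              (· ∈ (Set.toFinite (bondsIn (k + 1) (s'.Ω (k + 1))ᶜ)).toFinset)).symm (avgRestrOfRecord F N p.K k (Set.toFinite (bondsIn k (s'.Ω (k + 1))ᶜ)).toFinset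
                (Set.toFinite (bondsIn (k + 1) (s'.Ω (k + 1))ᶜ)).toFinset z.1, z.2))) k).2))) :
    ∀ k, k ≤ p.K → SLaw₁₃CoPH F N θ p k :=
  sLaw₁₃CoPH_all_of_supplyChainAt h hsel hθ hκ hE₀ hB₀ hM
    (supplyChainAt_of_bounds_of_condExp_of_gaussCert θ hζ hq h hM p σ hloc hunivE hnewE hσ hbounds hce)

/-- ★★★ **THE THEOREM OF p. 245 IN LAW FORM AT A GAUSSIAN-CLASS `θ` — `∀ k < K, SLaw₁₃CoPH θ p k → TLaw₁₃CoPH θ p k` — FROM THE SAME.**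
[cite: Balaban1988Convergent, Theorem p.245, Thm 1 p.262, remark p.262, §3 p.279, (3.24)–(3.25) p.270] -/
theorem thmP245Laws_of_bounds_of_condExp_of_gaussCert (θ : Stage13HParams F N)
    -- the Gaussian certificate class (dag-n11-w1): the certificate's `ζ0`, the Gaussian of the integrated variables as `quad`
    (hζ : ∀ (p : B12.RunParams) (n : ℕ) (Ω Λ : ℕ → Set (Site (F.P p.K) 0)), (θ.Zh p n Ω Λ).ζ0 = (ZhPinOfRecord₁₃ θ.toStage13Params p Ω Λ).ζ0)
    (hq : ∀ (p : B12.RunParams) (n : ℕ) (Ω Λ : ℕ → Set (Site (F.P p.K) 0)) (j : ℕ) (Λ' : Set (Site (F.P p.K) 0)) (ω : MultiCfg (F.P p.K) (SU N) (FluctV N)),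
      (θ.Zh p n Ω Λ).quad j Λ' ω = ∑ b ∈ (Set.toFinite (bondsIn j (Λ'ᶜ ∩ Ω (j + 1)))).toFinset, ‖(ω j).2 b‖ ^ 2)
    (h : θ.Provisos₁₃CoPH F N) (hM : 1 ≤ θ.τ9.M)
    (hsel : θ.ppSel = ppSelLiveOfRecord F N θ.ν θ.τ9 (EOfRecord₁₃ F N θ.toStage13Params) (wOfRecord₉ F N θ.toStage9Params))
    (hθ : θ.Admissible F N) (hκ : 0 ≤ θ.s2.lf.κ) (hE₀ : 0 ≤ θ.s2.lf.E₀) (hB₀ : 0 ≤ θ.s2.lf.B₀)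
    (p : B12.RunParams)
    (σ : Sect3Supplier θ p)
    -- the supplier's own data: locality (2.40)–(2.41), universality in 𝐄, the level-`(k+1)` 𝐄-clauses, the term rows of its constructed terms
    (hloc : ∀ k (s : SeqOfRecord F θ.ν θ.τ9.M (gOfRecord₁₃ F N θ.toStage13Params p) p.K (k + 1)), IsFluctLocal (k + 1) ((σ k (chainWitness θ p σ k).1 (chainWitness θ p σ k).2).1 s))
    (hunivE : ∀ k, k < p.K → ChainFormAt θ p σ k → Sect2.UniversalE (σ k (chainWitness θ p σ k).1 (chainWitness θ p σ k).2).1)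
    (hnewE : ∀ k, k < p.K → ChainFormAt θ p σ k →
      ∀ s : SeqOfRecord F θ.ν θ.τ9.M (gOfRecord₁₃ F N θ.toStage13Params p) p.K (k + 1), NewEClausesAt θ p k ((σ k (chainWitness θ p σ k).1 (chainWitness θ p σ k).2).1 s) s)
    (hσ : SupplierTermRows θ p σ)
    -- THE NEW-TERM BOUNDS (O1′) + (O2) of [III] Thm 2 at every 𝐓-present child, for the supplier's response (displayed)
    (hbounds : ∀ k (hkK : k < p.K), ChainFormAt θ p σ k →
      ∀ s' : SeqOfRecord F θ.ν θ.τ9.M (gOfRecord₁₃ F N θ.toStage13Params p) p.K (k + 1), s'.Ω (k + 1) ≠ ∅ →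
      slotsTOfRecord F N θ.ν θ.τ9 (EOfRecord₁₃ F N θ.toStage13Params) (wOfRecord₉ F N θ.toStage9Params) θ.ppSel p (gOfRecord₁₃ F N θ.toStage13Params p) (k + 1) s' ≠ 0 →
      (1 ≤ k →
        (∀ (X : (Sect2.domSys (F.P p.K) θ.τ9.M k).Dom) (φ : Sect2.CPair (F.P p.K) (MatA N)) (a : SFluct (F.P p.K) (FluctV N)),
          φ ∈ (sect2TowerOfRecord F N (FluctV N) p.K (settingOfRecord₁₃ F N θ.toStage13Params p) (θ.rzAt p s') s' ((σ k (chainWitness θ p σ k).1 (chainWitness θ p σ k).2).1 s')).spaceB k X →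
            ‖((σ k (chainWitness θ p σ k).1 (chainWitness θ p σ k).2).1 s').B k X φ a‖ ≤ (settingOfRecord₁₃ F N θ.toStage13Params p).lf.B₀ * Real.exp (-(settingOfRecord₁₃ F N θ.toStage13Params p).lf.κ * (Sect2.domSys (F.P p.K) θ.τ9.M k).dj X)) ∧
        (∀ (X : (Sect2.domSys (F.P p.K) θ.τ9.M k).Dom) (a : SFluct (F.P p.K) (FluctV N)),
          AnalyticOnNhd ℂ (fun φ => ((σ k (chainWitness θ p σ k).1 (chainWitness θ p σ k).2).1 s').B k X φ a) ((sect2TowerOfRecord F N (FluctV N) p.K (settingOfRecord₁₃ F N θ.toStage13Params p) (θ.rzAt p s') s' ((σ k (chainWitness θ p σ k).1 (chainWitness θ p σ k).2).1 s')).spaceB k X))) ∧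
      Step.LFNewTerms (sect2TowerOfRecord F N (FluctV N) p.K (settingOfRecord₁₃ F N θ.toStage13Params p) (θ.rzAt p s') s' ((σ k (chainWitness θ p σ k).1 (chainWitness θ p σ k).2).1 s')) (settingOfRecord₁₃ F N θ.toStage13Params p).lf (settingOfRecord₁₃ F N θ.toStage13Params p).βc k ∧
      (∀ (X : (Sect2.domSys (F.P p.K) θ.τ9.M (k + 1)).Dom) (z : Site (F.P p.K) (k + 1)) (g : ℝ), 0 ≤ g → g ≤ (settingOfRecord₁₃ F N θ.toStage13Params p).lf.γ →
        AnalyticOnNhd ℂ (((σ k (chainWitness θ p σ k).1 (chainWitness θ p σ k).2).1 s').E (k + 1) X z g)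
          ((sect2TowerOfRecord F N (FluctV N) p.K (settingOfRecord₁₃ F N θ.toStage13Params p) (θ.rzAt p s') s' ((σ k (chainWitness θ p σ k).1 (chainWitness θ p σ k).2).1 s')).space (k + 1) X ((settingOfRecord₁₃ F N θ.toStage13Params p).lf.alpha0 ((settingOfRecord₁₃ F N θ.toStage13Params p).flow.g (k + 1))) ((settingOfRecord₁₃ F N θ.toStage13Params p).lf.alpha1 ((settingOfRecord₁₃ F N θ.toStage13Params p).flow.g (k + 1))))) ∧
      (∀ X : (Sect2.domSys (F.P p.K) θ.τ9.M (k + 1)).Dom,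
        AnalyticOnNhd ℂ (((σ k (chainWitness θ p σ k).1 (chainWitness θ p σ k).2).1 s').R (k + 1) X)
          ((sect2TowerOfRecord F N (FluctV N) p.K (settingOfRecord₁₃ F N θ.toStage13Params p) (θ.rzAt p s') s' ((σ k (chainWitness θ p σ k).1 (chainWitness θ p σ k).2).1 s')).space (k + 1) X ((settingOfRecord₁₃ F N θ.toStage13Params p).lf.alpha0 ((settingOfRecord₁₃ F N θ.toStage13Params p).flow.g (k + 1))) ((settingOfRecord₁₃ F N θ.toStage13Params p).lf.alpha1 ((settingOfRecord₁₃ F N θ.toStage13Params p).flow.g (k + 1))))) ∧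
      (∀ (X : (Sect2.domSys (F.P p.K) θ.τ9.M (k + 1)).Dom) (a : SFluct (F.P p.K) (FluctV N)),
        AnalyticOnNhd ℂ (fun φ => ((σ k (chainWitness θ p σ k).1 (chainWitness θ p σ k).2).1 s').B (k + 1) X φ a) ((sect2TowerOfRecord F N (FluctV N) p.K (settingOfRecord₁₃ F N θ.toStage13Params p) (θ.rzAt p s') s' ((σ k (chainWitness θ p σ k).1 (chainWitness θ p σ k).2).1 s')).spaceB (k + 1) X)))
    -- THE CONDITIONAL-EXPECTATION IDENTITIES: per level `k < K` with Theorem 1's inductive hypothesis, per 𝐓-present child `s′` with `𝐓ρ_k(s′) ≢ 0`, per old branch `S₀`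
    (hce : ∀ k (hkK : k < p.K), ChainFormAt θ p σ k →
      ∀ s' : SeqOfRecord F θ.ν θ.τ9.M (gOfRecord₁₃ F N θ.toStage13Params p) p.K (k + 1), s'.Ω (k + 1) ≠ ∅ →
      slotsTOfRecord F N θ.ν θ.τ9 (EOfRecord₁₃ F N θ.toStage13Params) (wOfRecord₉ F N θ.toStage9Params) θ.ppSel p (gOfRecord₁₃ F N θ.toStage13Params p) (k + 1) s' ≠ 0 →
      ∀ S₀ ∈ admSOfRecord F θ.ν θ.τ9.M (gOfRecord₁₃ F N θ.toStage13Params p) p.K k s'.init, kernelTransport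
        ((Measure.pi fun _ : ↥(Set.toFinite (bondsIn k (s'.Ω (k + 1))ᶜ)).toFinset => (HaarData.haar : Measure (SU N))).prod
          (Measure.pi fun _ : {b : PBond (F.P p.K) k // b ∉ (Set.toFinite (bondsIn k (s'.Ω (k + 1))ᶜ)).toFinset} => (HaarData.haar : Measure (SU N))))
        ((Measure.pi fun _ : ↥(Set.toFinite (bondsIn k (s'.Ω (k + 1))ᶜ)).toFinset => (HaarData.haar : Measure (SU N))).prod
          (Measure.pi fun _ : {c : PBond (F.P p.K) (k + 1) // c ∉ (Set.toFinite (bondsIn (k + 1) (s'.Ω (k + 1))ᶜ)).toFinset} =>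
            (HaarData.haar : Measure (SU N))))
        (fun q => (q.1, fun c : {c : PBond (F.P p.K) (k + 1) // c ∉ (Set.toFinite (bondsIn (k + 1) (s'.Ω (k + 1))ᶜ)).toFinset} =>
          (avOfRecord F N p.K k).avg
            ((MeasurableEquiv.piEquivPiSubtypeProd (fun _ : PBond (F.P p.K) k => SU N)
              (· ∈ (Set.toFinite (bondsIn k (s'.Ω (k + 1))ᶜ)).toFinset)).symm q) c))
        ((fun U => wOfRecord₉ F N θ.toStage9Params p (gOfRecord₁₃ F N θ.toStage13Params p) k s' U ((avOfRecord F N p.K k).avg U) *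
            (chiSeqOfRecord F N θ.ν θ.τ9.M (gOfRecord₁₃ F N θ.toStage13Params p) p.K k s'.init U *
              tkBranchOfRecord F N (FluctV N) θ.ν θ.τ9.M (gOfRecord₁₃ F N θ.toStage13Params p) p.K (WtOfRecord₁₃H F N θ p s'.init) s'.init S₀ k
                (fun ω => (sect2Operand F N (FluctV N) p.K (settingOfRecord₁₃ F N θ.toStage13Params p) (θ.rzAt p s'.init) s'.init ((chainWitness θ p σ k).1 s'.init) ((chainWitness θ p σ k).2 s'.init)
            (UbgOfRecord₁₃CoP F N θ.toStage13Params p k s'.init)) (S₀, fun j => (ω j).2) (fun j => (ω j).1)) (baseCfg k U))) ∘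
          ⇑(MeasurableEquiv.piEquivPiSubtypeProd (fun _ : PBond (F.P p.K) k => SU N)
            (· ∈ (Set.toFinite (bondsIn k (s'.Ω (k + 1))ᶜ)).toFinset)).symm)
      =ᵐ[((Measure.pi fun _ : ↥(Set.toFinite (bondsIn k (s'.Ω (k + 1))ᶜ)).toFinset => (HaarData.haar : Measure (SU N))).prod
          (Measure.pi fun _ : {c : PBond (F.P p.K) (k + 1) // c ∉ (Set.toFinite (bondsIn (k + 1) (s'.Ω (k + 1))ᶜ)).toFinset} =>
            (HaarData.haar : Measure (SU N))))]
        fun z => ∑ Y ∈ (Set.toFinite {Y : Set (Site (F.P p.K) 0) | Y ∈ SClassOfRecord F θ.ν (gOfRecord₁₃ F N θ.toStage13Params p) p.K (k + 1) ∧ Y ⊆ s'.Ω (k + 1) ∩ (s'.Λ (k + 1))ᶜ}).toFinset,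
          zetaOp (genDataOfRecord F N (FluctV N) θ.ν θ.τ9.M (gOfRecord₁₃ F N θ.toStage13Params p) p.K (WtOfRecord₁₃H F N θ p s') s' (Function.update S₀ (k + 1) Y) k).ζ
            (aOp k (genDataOfRecord F N (FluctV N) θ.ν θ.τ9.M (gOfRecord₁₃ F N θ.toStage13Params p) p.K (WtOfRecord₁₃H F N θ p s') s' (Function.update S₀ (k + 1) Y) k).sA
              (genDataOfRecord F N (FluctV N) θ.ν θ.τ9.M (gOfRecord₁₃ F N θ.toStage13Params p) p.K (WtOfRecord₁₃H F N θ p s') s' (Function.update S₀ (k + 1) Y) k).w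
              (tkBranchOfRecord F N (FluctV N) θ.ν θ.τ9.M (gOfRecord₁₃ F N θ.toStage13Params p) p.K (WtOfRecord₁₃H F N θ p s') s'.init S₀ k
                (fun ω => (sect2Operand F N (FluctV N) p.K (settingOfRecord₁₃ F N θ.toStage13Params p) (θ.rzAt p s') s' (graftAboveB k ((chainWitness θ p σ k).1 s'.init) ((σ k (chainWitness θ p σ k).1 (chainWitness θ p σ k).2).1 s')) ((σ k (chainWitness θ p σ k).1 (chainWitness θ p σ k).2).2 s')
                  (UbgOfRecord₁₃CoP F N θ.toStage13Params p (k + 1) s')) (Function.update S₀ (k + 1) Y, fun j => (ω j).2) (fun j => (ω j).1))))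
            (Function.update (baseCfg (k + 1) ((MeasurableEquiv.piEquivPiSubtypeProd (fun _ : PBond (F.P p.K) (k + 1) => SU N)
              (· ∈ (Set.toFinite (bondsIn (k + 1) (s'.Ω (k + 1))ᶜ)).toFinset)).symm (avgRestrOfRecord F N p.K k (Set.toFinite (bondsIn k (s'.Ω (k + 1))ᶜ)).toFinset
                (Set.toFinite (bondsIn (k + 1) (s'.Ω (k + 1))ᶜ)).toFinset z.1, z.2))) k
            (Function.updateFinset ((baseCfg (V := FluctV N) (k + 1) ((MeasurableEquiv.piEquivPiSubtypeProd (fun _ : PBond (F.P p.K) (k + 1) => SU N)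
              (· ∈ (Set.toFinite (bondsIn (k + 1) (s'.Ω (k + 1))ᶜ)).toFinset)).symm (avgRestrOfRecord F N p.K k (Set.toFinite (bondsIn k (s'.Ω (k + 1))ᶜ)).toFinset
                (Set.toFinite (bondsIn (k + 1) (s'.Ω (k + 1))ᶜ)).toFinset z.1, z.2))) k).1 (Set.toFinite (bondsIn k (s'.Ω (k + 1))ᶜ)).toFinset z.1,
              ((baseCfg (V := FluctV N) (k + 1) ((MeasurableEquiv.piEquivPiSubtypeProd (fun _ : PBond (F.P p.K) (k + 1) => SU N)
              (· ∈ (Set.toFinite (bondsIn (k + 1) (s'.Ω (k + 1))ᶜ)).toFinset)).symm (avgRestrOfRecord F N p.K k (Set.toFinite (bondsIn k (s'.Ω (k + 1))ᶜ)).toFinset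
                (Set.toFinite (bondsIn (k + 1) (s'.Ω (k + 1))ᶜ)).toFinset z.1, z.2))) k).2))) :
    ∀ k, k < p.K → SLaw₁₃CoPH F N θ p k → TLaw₁₃CoPH F N θ p k :=
  thmP245Laws_of_supplyChainAt h hsel hθ hκ hE₀ hB₀ hM
    (supplyChainAt_of_bounds_of_condExp_of_gaussCert θ hζ hq h hM p σ hloc hunivE hnewE hσ hbounds hce)

end Summit.QuantumFields.YangMills.Theorems.BalabanUVNodesN11Thm1LawsOfCondExpGaussCert

end
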